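import Summits.AtomisticToContinuum.FouriersLaw.Theorems.EmbeddedDrudeMourreDrudeDissolutionStubGramContinuityUniformGap
import Literature.MathematicalPhysics.KineticTheory.InfiniteChainGibbsExistenceShift
import HarnessLib

/-!
# Stub G `stub_gramContinuity`, tool 4: uniform transfer data along the coupling ray
(line `gram-pencil-harmonic-chaos`, crux `EmbeddedDrudeMourre.DrudeDissolution`,
item stmt-AtomisticToContinuum-12593; `--supports` file, closes nothing)

WHAT. For the pencil `ε ↦ P_ε = pinnedChain ω₂ (aε) (bε) 1` (`ω₂ > 0`, `a, b ≥ 0`, `ε ∈ [0, 1]`) at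
unit temperature: Jentzsch transfer data `(λ(ε), h_ε)` of the transfer kernel
`K_ε(z, z') = e^{-V_ε(q' - q)}` on `L²(w_ε dz)`, `w_ε(q, p) = e^{-(p²/2 + U_ε(q))}` — the eigen-equation
`∫ K_ε(z, y) h_ε(y) w_ε(y) dy = λ(ε) h_ε(z)`, `∫ h_ε² w_ε = 1`, `0 < h_ε ≤ B` — with `B`, a lower bound
`λ_min > 0` and a contraction rate `r < 1` of the ground-state Markov operators on mean-zero
functions of `L²(h_ε² w_ε)` ALL UNIFORM in `ε ∈ [0, 1]`, and `λ`, `h_ε(z)` continuous in `ε`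
(`pencil_transfer_data`, registered sub-goal of stub G).

WHY. These are verbatim the hypotheses `heig`, `hnorm`, `hgap` of the tree's exponential-mixing
theorem `Literature.Probability.LatticeModels.abs_integral_mul_sub_le_of_dependsOn_halfLine` for the
two-sided stationary Markov chain of `K_ε` — which IS the unique shift-invariant DLR state of `P_ε`
(tool 5) — with an `ε`-independent rate: the uniform clustering of stub G; the continuity feeds the
continuity in `ε` of the finite-dimensional marginals.

PROOF. `kernel_family_uniform_markov_gap` (tool 3) applied on `L²(ρ₀)`, `ρ₀ = w₀ dz` the GAUSSIAN
one-site weight (`ε = 0`), to the symmetrised kernels `g_ε(z) K_ε(z,z') g_ε(z')`,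
`g_ε(q,p) = e^{-aε q⁴/8}` (so that `w_ε = w₀ g_ε²`; bounded by `1`, continuous in `ε`); the data are
transported back by `h_ε = h̃_ε / g_ε`, under which the ground-state Markov operator and the
invariant weight `h̃_ε² w₀ = h_ε² w_ε` are unchanged.
-/

noncomputable section

open MeasureTheory Set Filter Function Topology
open scoped InnerProductSpace ENNReal
open Literature.Analysis.OperatorTheory
open Literature.MathematicalPhysics.KineticTheory
open Literature.MathematicalPhysics.KineticTheory.HeatConduction
open Literature.MathematicalPhysics.KineticTheory.HeatConduction.OscillatorChain

namespace Summit.AtomisticToContinuum.FouriersLaw.Theorems.DrudeDissolution.GramPencilHarmonicChaos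

/-- **Uniform transfer data along the coupling ray** (named-hypotheses form of the registered
`pencil_transfer_data`). [folklore] -/
theorem pencil_transfer_data' {ω₂ a b : ℝ} (hω : 0 < ω₂) (ha : 0 ≤ a) (hb : 0 ≤ b) :
    ∃ (lam : ℝ → ℝ) (h : ℝ → ℝ × ℝ → ℝ) (B r lmin : ℝ), 0 ≤ r ∧ r < 1 ∧ 0 < lmin ∧
      ContinuousOn lam (Set.Icc 0 1) ∧ (∀ z, ContinuousOn (fun ε => h ε z) (Set.Icc 0 1)) ∧
      ∀ ε ∈ Set.Icc (0 : ℝ) 1, lmin ≤ lam ε ∧ Measurable (h ε) ∧ (∀ z, 0 < h ε z) ∧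
        (∀ z, h ε z ≤ B) ∧
        ∀ (K : ℝ × ℝ → ℝ × ℝ → ℝ) (wt : ℝ × ℝ → ℝ),
          (∀ x y, K x y = Real.exp (-(1 : ℝ)⁻¹ * (pinnedChain ω₂ (a * ε) (b * ε) 1).V (y.1 - x.1))) →
          (∀ y, wt y = Real.exp (-(1 : ℝ)⁻¹ *
            (y.2 ^ 2 / 2 + (pinnedChain ω₂ (a * ε) (b * ε) 1).U y.1))) →
          (∀ x, ∫ y, K x y * h ε y * wt y = lam ε * h ε x) ∧ ∫ y, h ε y ^ 2 * wt y = 1 ∧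
          ∀ q : ℝ × ℝ → ℝ × ℝ → ℝ, (∀ x y, q x y = (lam ε * h ε x)⁻¹ * K x y * h ε y * wt y) →
          ∀ u : ℝ × ℝ → ℝ, Measurable u → (∃ M : ℝ, ∀ x, |u x| ≤ M) →
            ∫ x, u x * (h ε x ^ 2 * wt x) = 0 → ∀ n : ℕ,
              ∫ x, ((fun (v : ℝ × ℝ → ℝ) (x : ℝ × ℝ) => ∫ y, q x y * v y)^[n] u) x ^ 2 *
                (h ε x ^ 2 * wt x) ≤ r ^ (2 * n) * ∫ x, u x ^ 2 * (h ε x ^ 2 * wt x) := by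
  classical
  set S : Set ℝ := Set.Icc 0 1 with hS
  have hSc : IsCompact S := isCompact_Icc
  -- the Gaussian reference weight and measure
  set wt0 : ℝ × ℝ → ℝ := fun z => Real.exp (-(1 : ℝ)⁻¹ * (z.2 ^ 2 / 2 + (pinnedChain ω₂ 0 0 1).U z.1))
    with hwt0
  have hwt0c : Continuous wt0 := by
    rw [hwt0]
    show Continuous fun z : ℝ × ℝ => Real.exp (-(1 : ℝ)⁻¹ * (z.2 ^ 2 / 2 + (ω₂ * z.1 ^ 2 / 2 + 0 * z.1 ^ 4 / 4)))
    fun_prop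
  have hwt0i : Integrable wt0 :=
    (pinnedChain ω₂ 0 0 1).integrable_siteWeight one_pos (integrable_exp_neg_pinning one_pos hω le_rfl 0 1)
  have hwt0pos : ∀ z, 0 < wt0 z := fun z => Real.exp_pos _
  set ρ : Measure (ℝ × ℝ) := volume.withDensity fun z => ENNReal.ofReal (wt0 z) with hρ
  haveI : IsFiniteMeasure ρ := isFiniteMeasure_withDensity_ofReal hwt0i.2
  have hwt0m : Measurable fun z => ENNReal.ofReal (wt0 z) :=
    ENNReal.measurable_ofReal.comp hwt0c.measurable
  have hρ0 : ρ ≠ 0 := by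
    intro h0
    have h1 : ρ univ = 0 := by rw [h0]; rfl
    rw [hρ, withDensity_apply _ MeasurableSet.univ, Measure.restrict_univ,
      lintegral_eq_zero_iff hwt0m] at h1
    have h2 : (volume : Measure (ℝ × ℝ))
        {z | (fun z => ENNReal.ofReal (wt0 z)) z ≠ (0 : ℝ × ℝ → ℝ≥0∞) z} = 0 := h1
    have h3 : {z : ℝ × ℝ | (fun z => ENNReal.ofReal (wt0 z)) z ≠ (0 : ℝ × ℝ → ℝ≥0∞) z} = univ :=
      eq_univ_of_forall fun z => (ENNReal.ofReal_pos.2 (hwt0pos z)).ne'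
    rw [h3] at h2
    exact (isOpen_univ.measure_pos (volume : Measure (ℝ × ℝ)) univ_nonempty).ne' h2
  have hconv : ∀ F : ℝ × ℝ → ℝ, ∫ y, F y ∂ρ = ∫ y, wt0 y * F y := fun F => by
    rw [hρ, integral_withDensity_eq_integral_toReal_smul hwt0m
      (ae_of_all _ fun _ => ENNReal.ofReal_lt_top)]
    refine integral_congr_ae (ae_of_all _ fun y => ?_)
    dsimp only
    rw [ENNReal.toReal_ofReal (hwt0pos y).le, smul_eq_mul]
  -- the symmetrising factor and the symmetrised kernels
  set g : ℝ → ℝ × ℝ → ℝ := fun ε z => Real.exp (-(a * ε) * z.1 ^ 4 / 8) with hg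
  have hgpos : ∀ ε z, 0 < g ε z := fun ε z => Real.exp_pos _
  have hg1 : ∀ ε ∈ S, ∀ z, g ε z ≤ 1 := fun ε hε z => by
    rw [hg]; dsimp only
    rw [Real.exp_le_one_iff]
    have : 0 ≤ a * ε := mul_nonneg ha hε.1
    have : 0 ≤ z.1 ^ 4 := by positivity
    nlinarith
  set Kt : ℝ → ℝ × ℝ → ℝ × ℝ → ℝ := fun ε z z' =>
    g ε z * Real.exp (-(1 : ℝ)⁻¹ * (pinnedChain ω₂ (a * ε) (b * ε) 1).V (z'.1 - z.1)) * g ε z'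
    with hKt
  have hKt_eq : ∀ ε z z', Kt ε z z' = Real.exp (-(a * ε) * z.1 ^ 4 / 8) *
      Real.exp (-(1 : ℝ)⁻¹ * ((z'.1 - z.1) ^ 2 / 2 + b * ε * (z'.1 - z.1) ^ 4 / 4)) *
      Real.exp (-(a * ε) * z'.1 ^ 4 / 8) := fun ε z z' => rfl
  have hKm : ∀ ε ∈ S, StronglyMeasurable (uncurry (Kt ε)) := fun ε _ => by
    refine Continuous.stronglyMeasurable ?_
    show Continuous fun p : (ℝ × ℝ) × (ℝ × ℝ) => Kt ε p.1 p.2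
    simp only [hKt_eq]
    fun_prop
  have hKC : ∀ ε ∈ S, ∀ x y, ‖Kt ε x y‖ ≤ 1 := fun ε hε x y => by
    rw [hKt_eq, Real.norm_eq_abs, abs_of_pos (by positivity)]
    have h1 := hg1 ε hε x
    have h2 := hg1 ε hε y
    have h3 : Real.exp (-(1 : ℝ)⁻¹ * ((y.1 - x.1) ^ 2 / 2 + b * ε * (y.1 - x.1) ^ 4 / 4)) ≤ 1 := by
      rw [Real.exp_le_one_iff]
      have : 0 ≤ b * ε := mul_nonneg hb hε.1
      have : 0 ≤ (y.1 - x.1) ^ 4 := by positivity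
      have : 0 ≤ (y.1 - x.1) ^ 2 := by positivity
      nlinarith
    simp only [hg] at h1 h2
    calc Real.exp (-(a * ε) * x.1 ^ 4 / 8) *
          Real.exp (-(1 : ℝ)⁻¹ * ((y.1 - x.1) ^ 2 / 2 + b * ε * (y.1 - x.1) ^ 4 / 4)) *
          Real.exp (-(a * ε) * y.1 ^ 4 / 8) ≤ 1 * 1 * 1 := by
          gcongr
      _ = 1 := by ring
  have hKs : ∀ ε ∈ S, ∀ x y, Kt ε x y = Kt ε y x := fun ε _ x y => by
    rw [hKt_eq, hKt_eq]
    have e : (x.1 - y.1) ^ 2 / 2 + b * ε * (x.1 - y.1) ^ 4 / 4 =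
        (y.1 - x.1) ^ 2 / 2 + b * ε * (y.1 - x.1) ^ 4 / 4 := by ring
    rw [e]; ring
  have hKp : ∀ ε ∈ S, ∀ x y, 0 < Kt ε x y := fun ε _ x y => by rw [hKt_eq]; positivity
  have hKc : ∀ x y, ContinuousOn (fun ε => Kt ε x y) S := fun x y => by
    refine Continuous.continuousOn ?_
    simp only [hKt_eq]
    fun_prop
  -- the uniform Jentzsch / Markov data on `L²(ρ₀)`
  obtain ⟨lam, ht, Bt, r, lmin, hr0, hr1, hlmin, hlamc, hhtc, hall⟩ :=
    kernel_family_uniform_markov_gap' (μ := ρ) hρ0 hSc hKm hKC hKs hKp hKc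
  -- transport back: `h_ε = h̃_ε / g_ε`
  set h : ℝ → ℝ × ℝ → ℝ := fun ε z => ht ε z / g ε z with hh
  set M : ℝ := ρ.real univ with hM
  have hBt0 : 0 ≤ Bt := by
    obtain ⟨-, -, hpos, hle, -⟩ := hall 0 ⟨le_rfl, zero_le_one⟩
    exact (hpos (0, 0)).le.trans (hle (0, 0))
  set B : ℝ := lmin⁻¹ * (Bt * M) with hB
  refine ⟨lam, h, B, r, lmin, hr0, hr1, hlmin, hlamc, fun z => ?_, fun ε hε => ?_⟩
  · -- continuity of `ε ↦ h ε z`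
    have hgc : Continuous fun ε => g ε z := by simp only [hg]; fun_prop
    exact (hhtc z).div hgc.continuousOn fun ε _ => (hgpos ε z).ne'
  obtain ⟨hlamε, hhtm, hhtpos, hhtle, -, heigt, -, hnormt, hgapt⟩ := hall ε hε
  have hlam : 0 < lam ε := hlmin.trans_le hlamε
  have hgm : Measurable (g ε) := by
    have : Continuous (g ε) := by simp only [hg]; fun_prop
    exact this.measurable
  have hhpos : ∀ z, 0 < h ε z := fun z => div_pos (hhtpos z) (hgpos ε z)
  have hht_eq : ∀ z, ht ε z = g ε z * h ε z := fun z => by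
    rw [hh]; dsimp only; rw [mul_div_cancel₀ _ (hgpos ε z).ne']
  refine ⟨hlamε, hhtm.div hgm, hhpos, fun z => ?_, fun K wt hK hwt => ?_⟩
  · -- the uniform bound: `λ h̃(z) = ∫ K̃(z,y) h̃(y) dρ₀ ≤ g(z) B̃ ρ₀(univ)`
    have h1 : lam ε * ht ε z ≤ g ε z * (Bt * M) := by
      rw [← heigt z]
      have h2 : ∀ y, Kt ε z y * ht ε y ≤ g ε z * Bt := fun y => by
        rw [hKt]; dsimp only
        have e1 := hg1 ε hε y
        have e2 : Real.exp (-(1 : ℝ)⁻¹ * (pinnedChain ω₂ (a * ε) (b * ε) 1).V (y.1 - z.1)) ≤ 1 := by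
          rw [Real.exp_le_one_iff]
          show -(1 : ℝ)⁻¹ * ((y.1 - z.1) ^ 2 / 2 + b * ε * (y.1 - z.1) ^ 4 / 4) ≤ 0
          have : 0 ≤ b * ε := mul_nonneg hb hε.1
          have : 0 ≤ (y.1 - z.1) ^ 4 := by positivity
          have : 0 ≤ (y.1 - z.1) ^ 2 := by positivity
          nlinarith
        have e3 := hhtle y
        have e4 := (hhtpos y).le
        have e5 := (hgpos ε z).le
        have e6 := (hgpos ε y).le
        have e7 : 0 ≤ Real.exp (-(1 : ℝ)⁻¹ * (pinnedChain ω₂ (a * ε) (b * ε) 1).V (y.1 - z.1)) :=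
          (Real.exp_pos _).le
        calc g ε z * Real.exp (-(1 : ℝ)⁻¹ * (pinnedChain ω₂ (a * ε) (b * ε) 1).V (y.1 - z.1)) *
            g ε y * ht ε y ≤ g ε z * 1 * 1 * Bt := by gcongr
          _ = g ε z * Bt := by ring
      calc ∫ y, Kt ε z y * ht ε y ∂ρ ≤ ∫ _y, g ε z * Bt ∂ρ :=
            integral_mono_of_nonneg (ae_of_all _ fun y => (mul_pos (hKp ε hε z y) (hhtpos y)).le)
              (integrable_const _) (ae_of_all _ h2)
        _ = g ε z * (Bt * M) := by
            rw [integral_const, smul_eq_mul, hM]; ring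
    have h3 : h ε z = (lam ε)⁻¹ * (lam ε * ht ε z) / g ε z := by
      rw [hh]; dsimp only; rw [← mul_assoc, inv_mul_cancel₀ hlam.ne', one_mul]
    rw [h3, hB, div_le_iff₀ (hgpos ε z)]
    have h4 : (lam ε)⁻¹ ≤ lmin⁻¹ := (inv_le_inv₀ hlam hlmin).2 hlamε
    have h5 : 0 ≤ Bt * M := by positivity
    calc (lam ε)⁻¹ * (lam ε * ht ε z) ≤ (lam ε)⁻¹ * (g ε z * (Bt * M)) :=
          mul_le_mul_of_nonneg_left h1 (inv_pos.2 hlam).le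
      _ = g ε z * ((lam ε)⁻¹ * (Bt * M)) := by ring
      _ ≤ g ε z * (lmin⁻¹ * (Bt * M)) := by gcongr
      _ = lmin⁻¹ * (Bt * M) * g ε z := by ring
  -- the weight identity `wt = wt0 g²` and the kernel identity `K̃ = g K g`
  have hwt_eq : ∀ y, wt y = wt0 y * g ε y ^ 2 := fun y => by
    rw [hwt, hwt0, hg]; dsimp only
    show Real.exp (-(1 : ℝ)⁻¹ * (y.2 ^ 2 / 2 + (ω₂ * y.1 ^ 2 / 2 + a * ε * y.1 ^ 4 / 4))) =
      Real.exp (-(1 : ℝ)⁻¹ * (y.2 ^ 2 / 2 + (ω₂ * y.1 ^ 2 / 2 + 0 * y.1 ^ 4 / 4))) *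
        Real.exp (-(a * ε) * y.1 ^ 4 / 8) ^ 2
    rw [pow_two (Real.exp (-(a * ε) * y.1 ^ 4 / 8)), ← Real.exp_add, ← Real.exp_add]
    congr 1; ring
  have hKt_K : ∀ x y, Kt ε x y = g ε x * K x y * g ε y := fun x y => by rw [hKt, hK]
  have hwtpos : ∀ y, 0 < wt y := fun y => by rw [hwt]; exact Real.exp_pos _
  refine ⟨fun x => ?_, ?_, fun q hq u hum hub hmean n => ?_⟩
  · -- the eigen-equation
    have h1 := heigt x
    rw [hconv] at h1
    have h2 : ∫ y, wt0 y * (Kt ε x y * ht ε y) = g ε x * ∫ y, K x y * h ε y * wt y := by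
      rw [← integral_const_mul]
      refine integral_congr_ae (ae_of_all _ fun y => ?_)
      dsimp only
      rw [hKt_K, hht_eq, hwt_eq]; ring
    rw [h2, hht_eq x] at h1
    have h3 : g ε x * ∫ y, K x y * h ε y * wt y = g ε x * (lam ε * h ε x) := by rw [h1]; ring
    exact mul_left_cancel₀ (hgpos ε x).ne' h3
  · -- the normalisation
    rw [← hnormt, hconv]
    refine integral_congr_ae (ae_of_all _ fun y => ?_)
    dsimp only
    rw [hht_eq, hwt_eq]; ring
  · -- the Markov gap: same operator, same invariant weight
    have hweight : ∀ F : ℝ × ℝ → ℝ, ∫ x, F x * ht ε x ^ 2 ∂ρ = ∫ x, F x * (h ε x ^ 2 * wt x) := by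
      intro F
      rw [hconv]
      refine integral_congr_ae (ae_of_all _ fun x => ?_)
      dsimp only
      rw [hht_eq, hwt_eq]; ring
    have hop : (fun (v : ℝ × ℝ → ℝ) (x : ℝ × ℝ) => ∫ y, (lam ε * ht ε x)⁻¹ * Kt ε x y * ht ε y * v y ∂ρ) =
        fun (v : ℝ × ℝ → ℝ) (x : ℝ × ℝ) => ∫ y, q x y * v y := by
      funext v x
      rw [hconv]
      refine integral_congr_ae (ae_of_all _ fun y => ?_)
      dsimp only
      rw [hq, hKt_K, hht_eq, hht_eq, hwt_eq]
      have := (hgpos ε x).ne'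
      have := (hhpos x).ne'
      have := hlam.ne'
      field_simp
    have hmean' : ∫ x, u x * ht ε x ^ 2 ∂ρ = 0 := by rw [hweight, hmean]
    have h1 := hgapt u hum hub hmean' n
    rw [hop, hweight, hweight] at h1
    exact h1

/-- **Uniform transfer data along the coupling ray** (registered sub-goal of stub G; see
`pencil_transfer_data'`). [folklore] -/
theorem pencil_transfer_data : ∀ ω₂ a b : ℝ, 0 < ω₂ → 0 ≤ a → 0 ≤ b →
    ∃ (lam : ℝ → ℝ) (h : ℝ → ℝ × ℝ → ℝ) (B r lmin : ℝ), 0 ≤ r ∧ r < 1 ∧ 0 < lmin ∧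
      ContinuousOn lam (Set.Icc 0 1) ∧ (∀ z, ContinuousOn (fun ε => h ε z) (Set.Icc 0 1)) ∧
      ∀ ε ∈ Set.Icc (0 : ℝ) 1, lmin ≤ lam ε ∧ Measurable (h ε) ∧ (∀ z, 0 < h ε z) ∧
        (∀ z, h ε z ≤ B) ∧
        ∀ (K : ℝ × ℝ → ℝ × ℝ → ℝ) (wt : ℝ × ℝ → ℝ),
          (∀ x y, K x y = Real.exp (-(1 : ℝ)⁻¹ *
            (Literature.MathematicalPhysics.KineticTheory.HeatConduction.pinnedChain
              ω₂ (a * ε) (b * ε) 1).V (y.1 - x.1))) →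
          (∀ y, wt y = Real.exp (-(1 : ℝ)⁻¹ * (y.2 ^ 2 / 2 +
            (Literature.MathematicalPhysics.KineticTheory.HeatConduction.pinnedChain
              ω₂ (a * ε) (b * ε) 1).U y.1))) →
          (∀ x, ∫ y, K x y * h ε y * wt y = lam ε * h ε x) ∧ ∫ y, h ε y ^ 2 * wt y = 1 ∧
          ∀ q : ℝ × ℝ → ℝ × ℝ → ℝ, (∀ x y, q x y = (lam ε * h ε x)⁻¹ * K x y * h ε y * wt y) →
          ∀ u : ℝ × ℝ → ℝ, Measurable u → (∃ M : ℝ, ∀ x, |u x| ≤ M) →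
            ∫ x, u x * (h ε x ^ 2 * wt x) = 0 → ∀ n : ℕ,
              ∫ x, ((fun (v : ℝ × ℝ → ℝ) (x : ℝ × ℝ) => ∫ y, q x y * v y)^[n] u) x ^ 2 *
                (h ε x ^ 2 * wt x) ≤ r ^ (2 * n) * ∫ x, u x ^ 2 * (h ε x ^ 2 * wt x) :=
  fun _ _ _ hω ha hb => pencil_transfer_data' hω ha hb

end Summit.AtomisticToContinuum.FouriersLaw.Theorems.DrudeDissolution.GramPencilHarmonicChaos

end
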